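import Summits.BirchSwinnertonDyer.BirchSwinnertonDyer.Theorems.PrintCf2SplitBadTwoLocalControlKernelDyadicSeven
import HarnessLib

/-!
# Crux `PrintCf2.SplitBadTwoRankOneOfFacts` (stmt-BirchSwinnertonDyer-20368), road α v10.3 — brick B15 file 13: THE (R-DYADIC) TABLE, ASSEMBLED —
# `v₂ #LK_{v̄} = e_{v̄}([d]₂)` on every S3c key from (C3-loc) alone, in the LEAD's hypothesis shape (fifth cut p66xxxx `restrictedControl_two_of_residuals_noC1`, `hDy`)

Cell `bsd-print-cf2`, width seat `bsd-line-cf2-p1-w2` g9 (prover-bsd-line-cf2-p1-w2-g9-0); brick B15 (memo `Cruxes/SplitBadTwoRankOneOfFacts/B15-DYADIC-EXACT-w2g9.md`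
§3); `--supports stmt-BirchSwinnertonDyer-20368` (helper, Theses-free). HONEST FRAMING: nothing here closes the crux or a registered stub; BSD is not
proved by any of this; no summit statement is proved by this seat. No definition, no named fact, no `sorry`. Assembly of files 9, 11, 12.

WHAT. For every S3c member (`d ≠ 0` squarefree, `d ≢ 1 (4)`, `C • W = cm7^{(d)}`), `K` imaginary quadratic with `2 = v·v̄`, `π² = π − 2`, `r² = r − 2`, the pinning
clause at `v` for `W* = E[𝔮_r^∞]`, and a `ℤ₂`-line `κ'` satisfying (C3-loc) «`σ ∈ D_{v̄}` lies in `ker κ'` iff it acts on `W*` as `+1` or as `−1`»: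
* **`padicValNat_natCard_localKer_vbar_of_kerC3`** — `v₂ #LK_{v̄} = 1` if `d ≡ 7 (8)` or `d ≡ 2, 6, 10 (16)`, and `= 0` otherwise (i.e. `d ≡ 3 (8)` or
  `d ≡ 14 (16)`): the table `e_{v̄}([d]₂)` of memo §3 (keys (1,7), (0,1), (0,3), (0,5) ↦ 1; (1,3), (0,7) ↦ 0).
* **`exists_ev_padicValNat_natCard_localKer_vbar_of_kerC3`** — the same in the LEAD's displayed shape `∃ ev : ℤ → ℤ → ℤ, ∀ d …, v₂ #LK_{v̄} =
  ev (d % 2) ((d / (2 − d % 2)) % 8)` with (C3-loc) inserted after `κ'.IsUnramifiedOutside v̄`: (R-DYADIC) is thereby REDUCED to (C3-loc), the local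
  shape of `ker κ'` — the one class-field-theoretic input left in this lane (LEAD's (R-CFT): `ψ_{W*}` mod `±1` is a `ℤ₂`-line unramified outside `v̄`, unique).
presearch: as files 9–12 — held; no fact filed. beyond-print theorem: no.

References: [Rubin1999] §3 Lemma 3.6 (ii), Cor. 3.17; [Agboola2007] §3 Prop. 3.2, §6, Prop. 8.1; [GreenbergLNM1716] §3.
-/

noncomputable section

open scoped Classical

set_option linter.dupNamespace false
set_option autoImplicit false

namespace Summit.BirchSwinnertonDyer.BirchSwinnertonDyer.Theorems.PrintCf2.RestrictedSelmerPair

open NumberField IsDedekindDomain Field WeierstrassCurve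
open Literature.NumberTheory.EllipticCurves Literature.NumberTheory.EllipticCurves.GreenbergSelmer
open Literature.NumberTheory.GaloisRepresentations
open Summit.BirchSwinnertonDyer.BirchSwinnertonDyer.Theorems.PrintCf2.AdditiveAtSeven
open Summit.BirchSwinnertonDyer.BirchSwinnertonDyer.Theorems.PrintCf2.CMPrimes

variable {K : Type} [Field K] [NumberField K]

/-- **THE (R-DYADIC) TABLE from (C3-loc): `v₂ #LK_{v̄} = e_{v̄}([d]₂)`** — `1` on `d ≡ 7 (8)`, `d ≡ 2, 6, 10 (16)` (a mover in `ker κ' ⊓ D_{v̄}`, files 9, 11),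
`0` on `d ≡ 3 (8)`, `d ≡ 14 (16)` ((Hv̄-triv), files 9, 12). [cite: Agboola2007, §3 Prop. 3.2 and §6] [cite: Rubin1999, §3 Lemma 3.6 (ii) and Cor. 3.17] -/
theorem padicValNat_natCard_localKer_vbar_of_kerC3 {d : ℤ} (hd0 : d ≠ 0) (hsq : Squarefree d) (hd4 : d % 4 ≠ 1)
    (W : WeierstrassCurve ℚ) [W.IsElliptic]
    (C : VariableChange ℚ) (hC : C • W = cm7.quadraticTwist (d : ℚ)) (hK : IsImaginaryQuadratic K)
    (v vbar : HeightOneSpectrum (𝓞 K)) (hv : ((2 : ℕ) : 𝓞 K) ∈ v.asIdeal) (hvbar : ((2 : ℕ) : 𝓞 K) ∈ vbar.asIdeal)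
    (hne : vbar ≠ v) (π : (W.baseChange K).endRing) (hrel : (π : AddMonoid.End (W.baseChange K).geomPoints) * π = π - 2)
    {r : ℤ_[2]} (hr : r * r = r - 2)
    (hclause : ∀ τ ∈ GreenbergSelmer.inertia v, ∀ x : ↥((W.baseChange K).endEigenPrimaryTorsion 2 π r), τ • x = x ∨ τ • x = -x)
    (κ' : ZpExtension K 2)
    (hC3 : ∀ σ ∈ decomp vbar, σ ∈ κ'.kerSubgroup ↔
      ((∀ x : ↥((W.baseChange K).endEigenPrimaryTorsion 2 π r), σ • x = x) ∨
        (∀ x : ↥((W.baseChange K).endEigenPrimaryTorsion 2 π r), σ • x = -x))) :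
    (padicValNat 2 (Nat.card (resOfLe ↥((W.baseChange K).endEigenPrimaryTorsion 2 π r)
        (inf_le_inf_right (decomp vbar) (le_top : κ'.kerSubgroup ≤ ⊤))).ker) : ℤ) =
      if d % 8 = 7 ∨ d % 16 = 2 ∨ d % 16 = 6 ∨ d % 16 = 10 then 1 else 0 := by
  haveI : Fact (Nat.Prime 2) := ⟨Nat.prime_two⟩
  -- `4 ∤ d`
  have h4 : ¬ (4 : ℤ) ∣ d := fun h ↦ by
    obtain ⟨k, hk⟩ := h
    have h2 : IsUnit (2 : ℤ) := hsq 2 ⟨k, by rw [hk]; ring⟩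
    rw [Int.isUnit_iff] at h2
    omega
  have hcases : d % 8 = 3 ∨ d % 8 = 7 ∨ ((2 : ℤ) ∣ d ∧ ((d / 2) % 4 = 1 ∨ (d / 2) % 8 = 3 ∨ (d / 2) % 8 = 7)) := by omega
  rcases hcases with h3 | h7 | ⟨h2d, h1 | h3' | h7'⟩
  · rw [natCard_localKer_vbar_eq_one_of_frame_of_kerC3 hd0 h3 W C hC hK v vbar hv hvbar hne π hrel hr hclause κ' hC3, padicValNat_one_right,
      if_neg (by omega)]
    rfl
  · rw [natCard_localKer_vbar_eq_two_of_frame_of_kerC3 hd0 h7 W C hC hK v vbar hv hvbar hne π hrel hr hclause κ' hC3, padicValNat_self,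
      if_pos (Or.inl h7)]
    rfl
  · rw [natCard_localKer_vbar_eq_two_of_frame_of_kerC3_even_one hd0 hsq h2d h1 W C hC hK v vbar hv hvbar hne π hrel hr hclause κ' hC3,
      padicValNat_self, if_pos (by omega)]
    rfl
  · rw [natCard_localKer_vbar_eq_two_of_frame_of_kerC3_even_three hd0 hsq h2d h3' W C hC hK v vbar hv hvbar hne π hrel hr hclause κ' hC3,
      padicValNat_self, if_pos (by omega)]
    rfl
  · rw [natCard_localKer_vbar_eq_one_of_frame_of_kerC3_even_seven hd0 h2d h7' W C hC hK v vbar hv hvbar hne π hrel hr hclause κ' hC3,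
      padicValNat_one_right, if_neg (by omega)]
    rfl

omit [Field K] [NumberField K] in
/-- **(R-DYADIC) REDUCED TO (C3-loc), in the LEAD's displayed shape** (`hDy` of `restrictedControl_two_of_residuals_noC1` with (C3-loc) inserted after
`κ'.IsUnramifiedOutside v̄`): `∃ ev, v₂ #LK_{v̄} = ev (d % 2) ((d / (2 − d % 2)) % 8)` on every S3c frame. [cite: Agboola2007, §3 Prop. 3.2 and §6] -/
theorem exists_ev_padicValNat_natCard_localKer_vbar_of_kerC3 :
    ∃ ev : ℤ → ℤ → ℤ, ∀ (d : ℤ), d ≠ 0 → Squarefree d → d % 4 ≠ 1 →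
      ∀ (W : WeierstrassCurve ℚ) [W.IsElliptic] (C : VariableChange ℚ), C • W = cm7.quadraticTwist (d : ℚ) →
      ∀ (L : Type) [Field L] [NumberField L], IsImaginaryQuadratic L →
      ∀ (v vbar : HeightOneSpectrum (𝓞 L)),
        ((2 : ℕ) : 𝓞 L) ∈ v.asIdeal → ((2 : ℕ) : 𝓞 L) ∈ vbar.asIdeal → vbar ≠ v →
      ∀ (π : (W.baseChange L).endRing), (π : AddMonoid.End (W.baseChange L).geomPoints) * π = π - 2 →
      ∀ (r : ℤ_[2]), r * r = r - 2 →
        (∀ τ ∈ GreenbergSelmer.inertia v, ∀ x : ↥((W.baseChange L).endEigenPrimaryTorsion 2 π r), τ • x = x ∨ τ • x = -x) →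
      ∀ (κ' : ZpExtension L 2), κ'.IsUnramifiedOutside vbar →
        (∀ σ ∈ decomp vbar, σ ∈ κ'.kerSubgroup ↔
          ((∀ x : ↥((W.baseChange L).endEigenPrimaryTorsion 2 π r), σ • x = x) ∨
            (∀ x : ↥((W.baseChange L).endEigenPrimaryTorsion 2 π r), σ • x = -x))) →
        (padicValNat 2 (Nat.card (resOfLe ↥((W.baseChange L).endEigenPrimaryTorsion 2 π r)
          (inf_le_inf_right (decomp vbar) (le_top : κ'.kerSubgroup ≤ ⊤))).ker) : ℤ) = ev (d % 2) ((d / (2 - d % 2)) % 8) := by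
  refine ⟨fun i j ↦ if (i = 1 ∧ j = 7) ∨ (i = 0 ∧ (j = 1 ∨ j = 3 ∨ j = 5)) then 1 else 0, ?_⟩
  intro d hd0 hsq hd4 W _ C hC L _ _ hL v vbar hv hvbar hne π hrel r hr hclause κ' _ hC3
  rw [padicValNat_natCard_localKer_vbar_of_kerC3 hd0 hsq hd4 W C hC hL v vbar hv hvbar hne π hrel hr hclause κ' hC3]
  have h4 : ¬ (4 : ℤ) ∣ d := fun h ↦ by
    obtain ⟨k, hk⟩ := h
    have h2 : IsUnit (2 : ℤ) := hsq 2 ⟨k, by rw [hk]; ring⟩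
    rw [Int.isUnit_iff] at h2
    omega
  rcases (by omega : d % 2 = 1 ∨ d % 2 = 0) with h | h
  · rw [h, show (2 : ℤ) - 1 = 1 by norm_num, Int.ediv_one]
    show _ = if (1 : ℤ) = 1 ∧ d % 8 = 7 ∨ (1 : ℤ) = 0 ∧ (d % 8 = 1 ∨ d % 8 = 3 ∨ d % 8 = 5) then (1 : ℤ) else 0
    by_cases hc : d % 8 = 7 ∨ d % 16 = 2 ∨ d % 16 = 6 ∨ d % 16 = 10
    · rw [if_pos hc, if_pos (by omega)]
    · rw [if_neg hc, if_neg (by omega)]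
  · rw [h, sub_zero]
    show _ = if (0 : ℤ) = 1 ∧ d / 2 % 8 = 7 ∨ (0 : ℤ) = 0 ∧ (d / 2 % 8 = 1 ∨ d / 2 % 8 = 3 ∨ d / 2 % 8 = 5) then (1 : ℤ) else 0
    by_cases hc : d % 8 = 7 ∨ d % 16 = 2 ∨ d % 16 = 6 ∨ d % 16 = 10
    · rw [if_pos hc, if_pos (by omega)]
    · rw [if_neg hc, if_neg (by omega)]

end Summit.BirchSwinnertonDyer.BirchSwinnertonDyer.Theorems.PrintCf2.RestrictedSelmerPair

end
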